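import Mathlib
import Literature.Geometry.Symplectic.JNormalPushoff
import Literature.Geometry.Symplectic.JRotationBranchSolve
import HarnessLib

/-!
# Chart-level estimates for the rotation comparison (Wendl 2020, App. B, §B.2.5): static part

Flat model, dimension four, in the setting produced by
`Literature.Geometry.Symplectic.BranchNormalForm.exists_adaptedNormalForm`: a smooth chart `Θ`,
the `C¹` chart `ξ` of the domain with `ξ z₀ = 0`, `Dξ(z₀) = 𝟙`, the normal form
`Θ (u z) = ((ξ z)ᵏ, û (ξ z))`, and the transported structure `J₂` with `J₂ 0 = i`. This file
collects the STATIC estimates used to verify the hypotheses of the Cauchy–Riemann inequality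
`Literature.Geometry.Symplectic.NormalPushoff.norm_dbar_le_of_pushoff` (Prop. B.28) along the
rotated branch of `Literature/Geometry/Symplectic/JRotationBranchSolve.lean`:

* `xi_local_bounds`, `xi_symm_local_bounds`, `hasFDerivAt_symm_id`, `tendsto_symm_sub`,
  `tendsto_symm_sub_div` — the two `C¹` charts near the critical point: `‖Dξ‖, ‖Dξ⁻¹‖ ≤ 2`,
  `|ξ z| ≤ 2|z - z₀|`, `|ξ⁻¹ w - z₀| ≤ 2|w|`, `Dξ⁻¹(0) = 𝟙`, and `(ξ⁻¹ s - z₀)/s → 1`;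
* `direction_of_perturbed_axis`, `tangent_direction` — the tangent vector
  `t = D(Θ∘u)(z₀+ζ)·1 = k ζ^{k-1} e₁ + O(|ζ|ᵏ)` is non-zero and its direction is within `1/32` of a
  unit multiple of `e₁` once `C|ζ| ≤ k/128` (the input of
  `Literature.Geometry.Symplectic.TransverseProjector.norm_proj_le_of_near`);
* `structure_local_bounds` — near `0`: `‖J₂ - i‖ ≤ 1/8`, `‖J₂‖ ≤ 2`, a Lipschitz constant for `J₂`,
  and bounds for the normal frame `X = NormalPushoff.frame J₂` and its derivative;
* `pushoff_identity` — the fixed-point equations (B.20) say exactly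
  `Θ (u z') = p + X_η(p)` with `p = (θᵏ, û θ) = Θ (u (ξ⁻¹ θ))`: the push-off identity
  `g z' = g (φ̃ z') + X(g (φ̃ z')) η̃(z')` for `g = Θ ∘ u`, `φ̃ = ξ⁻¹ ∘ θ ∘ ξ`, `η̃ = η ∘ ξ`.

Everything is proved; no named facts.

## References

* C. Wendl, *Lectures on Contact 3-Manifolds, Holomorphic Curves and Intersection Theory*,
  Cambridge Tracts in Math. 220 (2020), App. B, Prop. B.28, Thm B.23, §B.2.3–§B.2.5. [Wendl2020]
* M. Micallef, B. White, *The structure of branch points in minimal surfaces and in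
  pseudoholomorphic curves*, Ann. of Math. 141 (1995), §6. [MicallefWhite1995]
-/

noncomputable section

open scoped Topology ContDiff
open Set Filter Metric Complex

namespace Literature.Geometry.Symplectic.RotationBranch

/-! ### C1. The `C¹` chart `ξ` near the critical point -/

/-- **Local bounds for `ξ`.** If `ξ` is `C¹` on its (open) source containing `B(z₀,ρ)`, with
`ξ z₀ = 0` and `Dξ(z₀) = 𝟙`, then on a smaller ball `‖Dξ‖ ≤ 2` and `|ξ z| ≤ 2 |z - z₀|`, and
`ξ z ≠ 0` for `z ≠ z₀`. [folklore] -/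
theorem xi_local_bounds (ξ : OpenPartialHomeomorph ℂ ℂ) {z₀ : ℂ} {ρ : ℝ} (hρ : 0 < ρ)
    (hsrc : ball z₀ ρ ⊆ ξ.source) (hξ0 : ξ z₀ = 0) (hξC1 : ContDiffOn ℝ 1 ξ ξ.source)
    (hfd0 : fderiv ℝ ξ z₀ = ContinuousLinearMap.id ℝ ℂ) :
    ∃ r₁ : ℝ, 0 < r₁ ∧ r₁ ≤ ρ ∧
      (∀ z ∈ ball z₀ r₁, DifferentiableAt ℝ ξ z ∧ ‖fderiv ℝ ξ z‖ ≤ 2) ∧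
      (∀ z ∈ ball z₀ r₁, ‖ξ z‖ ≤ 2 * ‖z - z₀‖) ∧
      (∀ z ∈ ball z₀ r₁, z ≠ z₀ → ξ z ≠ 0) := by
  have hz₀ : z₀ ∈ ξ.source := hsrc (mem_ball_self hρ)
  have hcont : ContinuousOn (fderiv ℝ ξ) ξ.source :=
    hξC1.continuousOn_fderiv_of_isOpen ξ.open_source le_rfl
  have hcz : ContinuousAt (fderiv ℝ ξ) z₀ := hcont.continuousAt (ξ.open_source.mem_nhds hz₀)
  have hev : ∀ᶠ z in 𝓝 z₀, ‖fderiv ℝ ξ z‖ < 2 := by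
    have h1 : ‖fderiv ℝ ξ z₀‖ < 2 := by
      rw [hfd0]; exact ContinuousLinearMap.norm_id_le.trans_lt (by norm_num)
    exact (hcz.norm.eventually (gt_mem_nhds h1))
  obtain ⟨r, hr, hrball⟩ := Metric.eventually_nhds_iff_ball.1 hev
  set r₁ : ℝ := min r ρ with hr₁
  have hr₁pos : 0 < r₁ := lt_min hr hρ
  have hsub : ball z₀ r₁ ⊆ ball z₀ ρ := ball_subset_ball (min_le_right _ _)
  have hsubr : ball z₀ r₁ ⊆ ball z₀ r := ball_subset_ball (min_le_left _ _)
  have hdiff : ∀ z ∈ ball z₀ r₁, DifferentiableAt ℝ ξ z := fun z hz =>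
    (hξC1.differentiableOn one_ne_zero).differentiableAt (ξ.open_source.mem_nhds (hsrc (hsub hz)))
  have hbd : ∀ z ∈ ball z₀ r₁, ‖fderiv ℝ ξ z‖ ≤ 2 := fun z hz => (hrball z (hsubr hz)).le
  refine ⟨r₁, hr₁pos, min_le_right _ _, fun z hz => ⟨hdiff z hz, hbd z hz⟩, fun z hz => ?_,
    fun z hz hne h0 => ?_⟩
  · have := (convex_ball z₀ r₁).norm_image_sub_le_of_norm_fderiv_le (𝕜 := ℝ) hdiff hbd
      (mem_ball_self hr₁pos) hz
    rwa [hξ0, sub_zero] at this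
  · exact hne (ξ.injOn (hsrc (hsub hz)) hz₀ (h0.trans hξ0.symm))

/-- **`Dξ⁻¹(0) = 𝟙`** for the inverse chart (from `Dξ(z₀) = 𝟙`, `ξ z₀ = 0`). [folklore] -/
theorem hasFDerivAt_symm_id (ξ : OpenPartialHomeomorph ℂ ℂ) {z₀ : ℂ} (hz₀ : z₀ ∈ ξ.source)
    (hξ0 : ξ z₀ = 0) (hξC1 : ContDiffOn ℝ 1 ξ ξ.source)
    (hfd0 : fderiv ℝ ξ z₀ = ContinuousLinearMap.id ℝ ℂ) :
    HasFDerivAt ξ.symm (ContinuousLinearMap.id ℝ ℂ) 0 := by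
  have h0t : (0 : ℂ) ∈ ξ.target := hξ0 ▸ ξ.map_source hz₀
  have hsymm0 : ξ.symm 0 = z₀ := by rw [← hξ0, ξ.left_inv hz₀]
  have hdiff : HasFDerivAt ξ ((ContinuousLinearEquiv.refl ℝ ℂ : ℂ ≃L[ℝ] ℂ) : ℂ →L[ℝ] ℂ)
      (ξ.symm 0) := by
    rw [hsymm0]
    have hd : DifferentiableAt ℝ ξ z₀ :=
      (hξC1.differentiableOn one_ne_zero).differentiableAt (ξ.open_source.mem_nhds hz₀)
    have := hd.hasFDerivAt
    rw [hfd0] at this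
    exact this
  have h := HasFDerivAt.of_local_left_inverse (ξ.continuousAt_symm h0t) hdiff
    (ξ.eventually_right_inverse h0t)
  simpa using h

/-- **Local bounds for `ξ⁻¹`.** On a small ball about `0`: `ξ⁻¹` is differentiable with
`‖Dξ⁻¹‖ ≤ 2`, `|ξ⁻¹ w - z₀| ≤ 2 |w|`, and `ξ⁻¹ w` lies in a prescribed ball `B(z₀, ρ')`.
[folklore] -/
theorem xi_symm_local_bounds (ξ : OpenPartialHomeomorph ℂ ℂ) {z₀ : ℂ} {ρ₁ ρ' : ℝ} (hρ₁ : 0 < ρ₁)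
    (hρ' : 0 < ρ') (hz₀ : z₀ ∈ ξ.source) (htgt : ball (0 : ℂ) ρ₁ ⊆ ξ.target) (hξ0 : ξ z₀ = 0)
    (hξC1 : ContDiffOn ℝ 1 ξ ξ.source) (hξsymmC1 : ContDiffOn ℝ 1 ξ.symm ξ.target)
    (hfd0 : fderiv ℝ ξ z₀ = ContinuousLinearMap.id ℝ ℂ) :
    ∃ r₂ : ℝ, 0 < r₂ ∧ r₂ ≤ ρ₁ ∧
      (∀ w ∈ ball (0 : ℂ) r₂, DifferentiableAt ℝ ξ.symm w ∧ ‖fderiv ℝ ξ.symm w‖ ≤ 2) ∧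
      (∀ w ∈ ball (0 : ℂ) r₂, ‖ξ.symm w - z₀‖ ≤ 2 * ‖w‖) ∧
      (∀ w ∈ ball (0 : ℂ) r₂, ξ.symm w ∈ ball z₀ ρ' ∧ ξ (ξ.symm w) = w) := by
  have h0t : (0 : ℂ) ∈ ξ.target := hξ0 ▸ ξ.map_source hz₀
  have hsymm0 : ξ.symm 0 = z₀ := by rw [← hξ0, ξ.left_inv hz₀]
  have hD0 : fderiv ℝ ξ.symm 0 = ContinuousLinearMap.id ℝ ℂ :=
    (hasFDerivAt_symm_id ξ hz₀ hξ0 hξC1 hfd0).fderiv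
  have hcont : ContinuousOn (fderiv ℝ ξ.symm) ξ.target :=
    hξsymmC1.continuousOn_fderiv_of_isOpen ξ.open_target le_rfl
  have hcz : ContinuousAt (fderiv ℝ ξ.symm) 0 := hcont.continuousAt (ξ.open_target.mem_nhds h0t)
  have hev : ∀ᶠ w in 𝓝 (0 : ℂ), ‖fderiv ℝ ξ.symm w‖ < 2 := by
    have h1 : ‖fderiv ℝ ξ.symm 0‖ < 2 := by
      rw [hD0]; exact ContinuousLinearMap.norm_id_le.trans_lt (by norm_num)
    exact hcz.norm.eventually (gt_mem_nhds h1)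
  obtain ⟨r, hr, hrball⟩ := Metric.eventually_nhds_iff_ball.1 hev
  set r₂ : ℝ := min (min r ρ₁) (ρ' / 2) with hr₂
  have hr₂pos : 0 < r₂ := lt_min (lt_min hr hρ₁) (by positivity)
  have hr₂r : r₂ ≤ r := (min_le_left _ _).trans (min_le_left _ _)
  have hr₂ρ₁ : r₂ ≤ ρ₁ := (min_le_left _ _).trans (min_le_right _ _)
  have hr₂ρ' : r₂ ≤ ρ' / 2 := min_le_right _ _
  have hsubt : ball (0 : ℂ) r₂ ⊆ ξ.target := (ball_subset_ball hr₂ρ₁).trans htgt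
  have hdiff : ∀ w ∈ ball (0 : ℂ) r₂, DifferentiableAt ℝ ξ.symm w := fun w hw =>
    (hξsymmC1.differentiableOn one_ne_zero).differentiableAt (ξ.open_target.mem_nhds (hsubt hw))
  have hbd : ∀ w ∈ ball (0 : ℂ) r₂, ‖fderiv ℝ ξ.symm w‖ ≤ 2 := fun w hw =>
    (hrball w (ball_subset_ball hr₂r hw)).le
  have hmv : ∀ w ∈ ball (0 : ℂ) r₂, ‖ξ.symm w - z₀‖ ≤ 2 * ‖w‖ := by
    intro w hw
    have := (convex_ball (0 : ℂ) r₂).norm_image_sub_le_of_norm_fderiv_le (𝕜 := ℝ) hdiff hbd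
      (mem_ball_self hr₂pos) hw
    rwa [hsymm0, sub_zero] at this
  refine ⟨r₂, hr₂pos, hr₂ρ₁, fun w hw => ⟨hdiff w hw, hbd w hw⟩, hmv, fun w hw => ⟨?_, ?_⟩⟩
  · rw [mem_ball, dist_eq_norm]
    have hw' : ‖w‖ < r₂ := mem_ball_zero_iff.1 hw
    calc ‖ξ.symm w - z₀‖ ≤ 2 * ‖w‖ := hmv w hw
      _ < 2 * r₂ := by gcongr
      _ ≤ ρ' := by linarith
  · exact ξ.right_inv (hsubt hw)

/-- `ξ⁻¹ s - z₀ → 0` within `≠ 0` as `s → 0` within `≠ 0` (continuity and injectivity of the chart).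
[folklore] -/
theorem tendsto_symm_sub (ξ : OpenPartialHomeomorph ℂ ℂ) {z₀ : ℂ} (hz₀ : z₀ ∈ ξ.source)
    (hξ0 : ξ z₀ = 0) :
    Tendsto (fun s => ξ.symm s - z₀) (𝓝[≠] 0) (𝓝[≠] 0) := by
  have h0t : (0 : ℂ) ∈ ξ.target := hξ0 ▸ ξ.map_source hz₀
  have hsymm0 : ξ.symm 0 = z₀ := by rw [← hξ0, ξ.left_inv hz₀]
  have hc : Tendsto (fun s => ξ.symm s - z₀) (𝓝 0) (𝓝 0) := by
    have h1 : ContinuousAt ξ.symm 0 := ξ.continuousAt_symm h0t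
    have h2 : Tendsto (fun s => ξ.symm s - z₀) (𝓝 0) (𝓝 (ξ.symm 0 - z₀)) :=
      h1.tendsto.sub_const z₀
    rwa [hsymm0, sub_self] at h2
  refine tendsto_nhdsWithin_of_tendsto_nhds_of_eventually_within _ (hc.mono_left nhdsWithin_le_nhds) ?_
  have hev : ∀ᶠ s in 𝓝[≠] (0 : ℂ), s ∈ ξ.target ∧ s ≠ 0 := by
    filter_upwards [mem_nhdsWithin_of_mem_nhds (ξ.open_target.mem_nhds h0t), self_mem_nhdsWithin]
      with s hs hs0
    exact ⟨hs, hs0⟩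
  filter_upwards [hev] with s hs
  intro h
  have h' : ξ.symm s = z₀ := sub_eq_zero.1 h
  have : s = 0 := by rw [← ξ.right_inv hs.1, h', hξ0]
  exact hs.2 this

/-- **`(ξ⁻¹ s - z₀)/s → 1`** as `s → 0`, `s ≠ 0` (from `Dξ⁻¹(0) = 𝟙`). [folklore] -/
theorem tendsto_symm_sub_div (ξ : OpenPartialHomeomorph ℂ ℂ) {z₀ : ℂ} (hz₀ : z₀ ∈ ξ.source)
    (hξ0 : ξ z₀ = 0) (hξC1 : ContDiffOn ℝ 1 ξ ξ.source)
    (hfd0 : fderiv ℝ ξ z₀ = ContinuousLinearMap.id ℝ ℂ) :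
    Tendsto (fun s => (ξ.symm s - z₀) / s) (𝓝[≠] 0) (𝓝 1) := by
  have h := hasFDerivAt_symm_id ξ hz₀ hξ0 hξC1 hfd0
  have hsymm0 : ξ.symm 0 = z₀ := by rw [← hξ0, ξ.left_inv hz₀]
  -- `‖ξ⁻¹ s - z₀ - s‖ = o(‖s‖)`
  have ho : (fun s => ξ.symm s - z₀ - s) =o[𝓝 0] fun s => s := by
    have := h.isLittleO
    simp only [hsymm0, sub_zero, ContinuousLinearMap.id_apply] at this
    exact this
  have ho' := ho.mono (nhdsWithin_le_nhds (s := {(0 : ℂ)}ᶜ))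
  have h1 : Tendsto (fun s => (ξ.symm s - z₀ - s) / s) (𝓝[≠] 0) (𝓝 0) :=
    ho'.tendsto_div_nhds_zero
  have h2 : Tendsto (fun s : ℂ => (ξ.symm s - z₀ - s) / s + 1) (𝓝[≠] 0) (𝓝 (0 + 1)) :=
    h1.add tendsto_const_nhds
  rw [zero_add] at h2
  refine h2.congr' ?_
  filter_upwards [self_mem_nhdsWithin] with s hs
  have hs' : s ≠ 0 := hs
  field_simp
  ring

/-! ### C2. The tangent direction near the critical point -/

/-- **Direction of a perturbed multiple of `e₁`.** If `a ≠ 0` and `‖E‖ ≤ ‖a‖/128` then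
`t = a • e₁ + E ≠ 0` and its direction is within `1/32` of `(a/|a|) e₁`. [folklore] -/
theorem direction_of_perturbed_axis {a : ℂ} (ha : a ≠ 0) {E : ℂ × ℂ} (hE : ‖E‖ ≤ ‖a‖ / 128) :
    a • ((((1 : ℂ), (0 : ℂ)) : ℂ × ℂ)) + E ≠ 0 ∧
      ‖((‖a‖ : ℂ)⁻¹ * a)‖ = 1 ∧
      ‖(‖a • ((((1 : ℂ), (0 : ℂ)) : ℂ × ℂ)) + E‖⁻¹ : ℝ) • (a • ((((1 : ℂ), (0 : ℂ)) : ℂ × ℂ)) + E) -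
          ((‖a‖ : ℂ)⁻¹ * a) • ((((1 : ℂ), (0 : ℂ)) : ℂ × ℂ))‖ ≤ 1 / 32 := by
  set e₁ : ℂ × ℂ := (((1 : ℂ), (0 : ℂ)) : ℂ × ℂ) with he₁
  have he₁n : ‖e₁‖ = 1 := by simp [he₁, Prod.norm_def]
  have han : 0 < ‖a‖ := norm_pos_iff.2 ha
  have hae : ‖a • e₁‖ = ‖a‖ := by rw [norm_smul, he₁n, mul_one]
  set t : ℂ × ℂ := a • e₁ + E with ht
  -- `‖t‖` is comparable to `‖a‖`
  have ht_lo : ‖a‖ - ‖a‖ / 128 ≤ ‖t‖ := by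
    have : ‖a • e₁‖ - ‖E‖ ≤ ‖a • e₁ + E‖ := by
      have := norm_sub_norm_le (a • e₁) (-E)
      rw [sub_neg_eq_add, norm_neg] at this
      linarith
    rw [hae] at this; linarith
  have ht_pos : 0 < ‖t‖ := by linarith
  have ht_ne : t ≠ 0 := norm_pos_iff.1 ht_pos
  have ht_sub : |‖t‖ - ‖a‖| ≤ ‖a‖ / 128 := by
    rw [abs_sub_le_iff]
    constructor
    · have : ‖t‖ ≤ ‖a • e₁‖ + ‖E‖ := norm_add_le _ _
      rw [hae] at this; linarith
    · linarith
  -- the unit scalar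
  have hc : ‖((‖a‖ : ℂ)⁻¹ * a)‖ = 1 := by
    rw [norm_mul, norm_inv, Complex.norm_real, Real.norm_of_nonneg han.le, inv_mul_cancel₀ han.ne']
  refine ⟨ht_ne, hc, ?_⟩
  -- decomposition of the difference
  have hX : (‖t‖⁻¹ : ℝ) • (a • e₁) - ((‖a‖ : ℂ)⁻¹ * a) • e₁ =
      (((‖t‖⁻¹ : ℝ) : ℂ) - (‖a‖ : ℂ)⁻¹) • (a • e₁) := by
    rw [sub_smul, Complex.coe_smul, smul_smul]
  have hdec : (‖t‖⁻¹ : ℝ) • t - ((‖a‖ : ℂ)⁻¹ * a) • e₁ =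
      (((‖t‖⁻¹ : ℝ) : ℂ) - (‖a‖ : ℂ)⁻¹) • (a • e₁) + (‖t‖⁻¹ : ℝ) • E := by
    rw [← hX, ht, smul_add]
    abel
  rw [hdec]
  have h1 : ‖(((‖t‖⁻¹ : ℝ) : ℂ) - (‖a‖ : ℂ)⁻¹) • (a • e₁)‖ ≤ 1 / 127 := by
    have hsc : ((‖t‖⁻¹ : ℝ) : ℂ) - (‖a‖ : ℂ)⁻¹ = ((‖t‖⁻¹ - ‖a‖⁻¹ : ℝ) : ℂ) := by
      push_cast; ring
    rw [hsc, norm_smul, Complex.norm_real, hae, Real.norm_eq_abs]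
    have hid : |‖t‖⁻¹ - ‖a‖⁻¹| * ‖a‖ = |‖a‖ - ‖t‖| / ‖t‖ := by
      rw [inv_sub_inv ht_pos.ne' han.ne', abs_div, abs_of_pos (mul_pos ht_pos han)]
      field_simp
    rw [hid, abs_sub_comm, div_le_iff₀ ht_pos]
    have : ‖a‖ / 128 ≤ 1 / 127 * (‖a‖ - ‖a‖ / 128) := by nlinarith
    linarith [ht_sub.trans this, mul_le_mul_of_nonneg_left ht_lo (by norm_num : (0 : ℝ) ≤ 1 / 127)]
  have h2 : ‖(‖t‖⁻¹ : ℝ) • E‖ ≤ 1 / 127 := by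
    rw [norm_smul, norm_inv, Real.norm_of_nonneg ht_pos.le, inv_mul_le_iff₀ ht_pos]
    calc ‖E‖ ≤ ‖a‖ / 128 := hE
      _ ≤ ‖t‖ * (1 / 127) := by nlinarith
  calc ‖(((‖t‖⁻¹ : ℝ) : ℂ) - (‖a‖ : ℂ)⁻¹) • (a • e₁) + (‖t‖⁻¹ : ℝ) • E‖
      ≤ ‖(((‖t‖⁻¹ : ℝ) : ℂ) - (‖a‖ : ℂ)⁻¹) • (a • e₁)‖ + ‖(‖t‖⁻¹ : ℝ) • E‖ := norm_add_le _ _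
    _ ≤ 1 / 127 + 1 / 127 := add_le_add h1 h2
    _ ≤ 1 / 32 := by norm_num

/-- The derivative of `z ↦ zᵏ • e₁` at `ζ` in the direction `1` is `k ζ^{k-1} • e₁`. [folklore] -/
theorem fderiv_pow_smul_apply_one (k : ℕ) (ζ : ℂ) :
    fderiv ℝ (fun z : ℂ => z ^ k • ((((1 : ℂ), (0 : ℂ)) : ℂ × ℂ))) ζ 1 =
      ((k : ℂ) * ζ ^ (k - 1)) • ((((1 : ℂ), (0 : ℂ)) : ℂ × ℂ)) := by
  have h1 : HasDerivAt (fun z : ℂ => z ^ k) ((k : ℂ) * ζ ^ (k - 1)) ζ := hasDerivAt_pow k ζ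
  have h3 := (h1.hasFDerivAt.restrictScalars ℝ).smul_const ((((1 : ℂ), (0 : ℂ)) : ℂ × ℂ))
  rw [h3.fderiv]
  simp

/-- **The tangent direction near the critical point.** If `‖D(h - (·)ᵏ • e₁)(ζ)‖ ≤ C |ζ|ᵏ` with
`ζ ≠ 0` and `C |ζ| ≤ k/128` (`k ≥ 1`, `h` differentiable at `ζ`), then `t = Dh(ζ)·1` is non-zero
and its direction is within `1/32` of the unit multiple `(a/|a|) e₁`, `a = k ζ^{k-1}`.
[cite: Wendl2020, App. B, §B.2.5] -/
theorem tangent_direction {h : ℂ → ℂ × ℂ} {k : ℕ} (hk : k ≠ 0) {C : ℝ} {ζ : ℂ} (hζ : ζ ≠ 0)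
    (hhd : DifferentiableAt ℝ h ζ)
    (hrem : ‖fderiv ℝ (fun z => h z - z ^ k • ((((1 : ℂ), (0 : ℂ)) : ℂ × ℂ))) ζ‖ ≤ C * ‖ζ‖ ^ k)
    (hsmall : C * ‖ζ‖ ≤ k / 128) :
    fderiv ℝ h ζ 1 ≠ 0 ∧
      ∃ c : ℂ, ‖c‖ = 1 ∧
        ‖(‖fderiv ℝ h ζ 1‖⁻¹ : ℝ) • fderiv ℝ h ζ 1 - c • ((((1 : ℂ), (0 : ℂ)) : ℂ × ℂ))‖ ≤ 1 / 32 := by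
  set e₁ : ℂ × ℂ := (((1 : ℂ), (0 : ℂ)) : ℂ × ℂ) with he₁
  set a : ℂ := (k : ℂ) * ζ ^ (k - 1) with ha_def
  have ha : a ≠ 0 := mul_ne_zero (Nat.cast_ne_zero.2 hk) (pow_ne_zero _ hζ)
  have han : ‖a‖ = k * ‖ζ‖ ^ (k - 1) := by
    rw [ha_def, norm_mul, Complex.norm_natCast, norm_pow]
  -- `Dh(ζ) 1 = a • e₁ + E`
  have hpd : DifferentiableAt ℝ (fun z : ℂ => z ^ k • e₁) ζ :=
    (((hasDerivAt_pow k ζ).hasFDerivAt.restrictScalars ℝ).smul_const e₁).differentiableAt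
  set E : ℂ × ℂ := fderiv ℝ (fun z => h z - z ^ k • e₁) ζ 1 with hE_def
  have hsplit : fderiv ℝ h ζ 1 = a • e₁ + E := by
    have hsub : fderiv ℝ (fun z => h z - z ^ k • e₁) ζ = fderiv ℝ h ζ - fderiv ℝ (fun z : ℂ => z ^ k • e₁) ζ :=
      fderiv_sub hhd hpd
    rw [hE_def, hsub, sub_apply, fderiv_pow_smul_apply_one]
    abel
  have hE : ‖E‖ ≤ ‖a‖ / 128 := by
    have h1 : ‖E‖ ≤ C * ‖ζ‖ ^ k := by
      calc ‖E‖ ≤ ‖fderiv ℝ (fun z => h z - z ^ k • e₁) ζ‖ * ‖(1 : ℂ)‖ :=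
            ContinuousLinearMap.le_opNorm _ _
        _ ≤ C * ‖ζ‖ ^ k * 1 := by rw [norm_one]; gcongr
        _ = C * ‖ζ‖ ^ k := mul_one _
    have h2 : C * ‖ζ‖ ^ k ≤ ‖a‖ / 128 := by
      have hk1 : k = (k - 1) + 1 := (Nat.succ_pred_eq_of_ne_zero hk).symm
      calc C * ‖ζ‖ ^ k = (C * ‖ζ‖) * ‖ζ‖ ^ (k - 1) := by
            conv_lhs => rw [hk1]
            rw [pow_succ]; ring
        _ ≤ (k / 128) * ‖ζ‖ ^ (k - 1) := by gcongr
        _ = ‖a‖ / 128 := by rw [han]; ring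
    exact h1.trans h2
  obtain ⟨hne, hc, hdir⟩ := direction_of_perturbed_axis ha hE
  rw [hsplit]
  exact ⟨hne, _, hc, hdir⟩

/-! ### C3. The transported structure and the frame near `0` -/

/-- **Local bounds for `J₂` and the normal frame.** If `J₂` is smooth on an open `V ∋ 0` with
`J₂ 0 = i`, there is a closed ball `B̄(0,δ) ⊆ V` on which `‖J₂ - i‖ ≤ 1/8`, `‖J₂‖ ≤ 2`, `J₂` is
`K`-Lipschitz, the frame satisfies `‖X(y)‖ ≤ 3` and `‖DX(y)‖ ≤ L₁`, and `X` is differentiable.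
[cite: Wendl2020, App. B, §B.2.3 and Lemma B.32] -/
theorem structure_local_bounds {J₂ : ℂ × ℂ → ℂ × ℂ →L[ℝ] ℂ × ℂ} {V : Set (ℂ × ℂ)} (hV : IsOpen V)
    (h0 : (0 : ℂ × ℂ) ∈ V) (hJ : ContDiffOn ℝ ∞ J₂ V) (hJ0 : ∀ v, J₂ 0 v = I • v) :
    ∃ (δ K L₁ : ℝ), 0 < δ ∧ 0 ≤ K ∧ 0 ≤ L₁ ∧ closedBall (0 : ℂ × ℂ) δ ⊆ V ∧
      (∀ y ∈ closedBall (0 : ℂ × ℂ) δ, ‖J₂ y - I • ContinuousLinearMap.id ℝ (ℂ × ℂ)‖ ≤ 1 / 8) ∧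
      (∀ y ∈ closedBall (0 : ℂ × ℂ) δ, ‖J₂ y‖ ≤ 2) ∧
      (∀ y ∈ closedBall (0 : ℂ × ℂ) δ, ∀ y' ∈ closedBall (0 : ℂ × ℂ) δ,
        ‖J₂ y - J₂ y'‖ ≤ K * ‖y - y'‖) ∧
      (∀ y ∈ closedBall (0 : ℂ × ℂ) δ, ‖NormalPushoff.frame J₂ y‖ ≤ 3) ∧
      (∀ y ∈ closedBall (0 : ℂ × ℂ) δ,
        HasFDerivAt (NormalPushoff.frame J₂) (fderiv ℝ (NormalPushoff.frame J₂) y) y ∧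
          ‖fderiv ℝ (NormalPushoff.frame J₂) y‖ ≤ L₁) := by
  have hJ0' : J₂ 0 = I • ContinuousLinearMap.id ℝ (ℂ × ℂ) := by
    ext v <;> simp [hJ0]
  -- `‖J₂ - i‖ ≤ 1/8` near `0`
  have hcJ : ContinuousAt J₂ 0 := (hJ.continuousOn.continuousAt (hV.mem_nhds h0))
  have hev : ∀ᶠ y in 𝓝 (0 : ℂ × ℂ), ‖J₂ y - I • ContinuousLinearMap.id ℝ (ℂ × ℂ)‖ < 1 / 8 := by
    have : Tendsto (fun y => J₂ y - I • ContinuousLinearMap.id ℝ (ℂ × ℂ)) (𝓝 0) (𝓝 0) := by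
      have h2 : Tendsto (fun y => J₂ y - I • ContinuousLinearMap.id ℝ (ℂ × ℂ)) (𝓝 0)
          (𝓝 (J₂ 0 - I • ContinuousLinearMap.id ℝ (ℂ × ℂ))) := hcJ.tendsto.sub_const _
      rwa [hJ0', sub_self] at h2
    have := this.norm
    rw [norm_zero] at this
    exact this.eventually (gt_mem_nhds (by norm_num))
  obtain ⟨δ₀, hδ₀, hδ₀V⟩ := Metric.isOpen_iff.1 hV 0 h0
  obtain ⟨δ₁, hδ₁, hδ₁b⟩ := Metric.eventually_nhds_iff_ball.1 hev
  set δ : ℝ := min (δ₀ / 2) (δ₁ / 2) with hδ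
  have hδpos : 0 < δ := lt_min (by positivity) (by positivity)
  have hKV : closedBall (0 : ℂ × ℂ) δ ⊆ V :=
    (closedBall_subset_ball ((min_le_left _ _).trans_lt (by linarith))).trans hδ₀V
  have hK1 : closedBall (0 : ℂ × ℂ) δ ⊆ ball 0 δ₁ :=
    closedBall_subset_ball ((min_le_right _ _).trans_lt (by linarith))
  have hKc : IsCompact (closedBall (0 : ℂ × ℂ) δ) := isCompact_closedBall 0 δ
  have hKconv : Convex ℝ (closedBall (0 : ℂ × ℂ) δ) := convex_closedBall 0 δ
  have hnear : ∀ y ∈ closedBall (0 : ℂ × ℂ) δ, ‖J₂ y - I • ContinuousLinearMap.id ℝ (ℂ × ℂ)‖ ≤ 1 / 8 :=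
    fun y hy => (hδ₁b y (hK1 hy)).le
  have hJn : ∀ y ∈ closedBall (0 : ℂ × ℂ) δ, ‖J₂ y‖ ≤ 2 := by
    intro y hy
    have h1 : ‖J₂ y‖ ≤ ‖J₂ y - I • ContinuousLinearMap.id ℝ (ℂ × ℂ)‖ + ‖I • ContinuousLinearMap.id ℝ (ℂ × ℂ)‖ :=
      norm_le_norm_sub_add _ _
    have h2 : ‖I • ContinuousLinearMap.id ℝ (ℂ × ℂ)‖ ≤ 1 := by
      rw [norm_smul, norm_I, one_mul]; exact ContinuousLinearMap.norm_id_le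
    linarith [hnear y hy]
  -- Lipschitz constant of `J₂`
  obtain ⟨K, hK⟩ := (hJ.mono hKV).exists_lipschitzOnWith (by simp) hKconv hKc
  -- the frame and its derivative
  have hframe : ContDiffOn ℝ ∞ (NormalPushoff.frame J₂) V := NormalPushoff.contDiffOn_frame hJ
  have hframe1 : ContDiffOn ℝ 1 (NormalPushoff.frame J₂) V := hframe.of_le (by norm_cast)
  have hDframe : ContinuousOn (fderiv ℝ (NormalPushoff.frame J₂)) V :=
    hframe1.continuousOn_fderiv_of_isOpen hV le_rfl
  obtain ⟨L₁, hL₁⟩ :=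
    hKc.exists_bound_of_continuousOn (f := fderiv ℝ (NormalPushoff.frame J₂)) (hDframe.mono hKV)
  refine ⟨δ, K, max L₁ 0, hδpos, K.2, le_max_right _ _, hKV, hnear, hJn, ?_, ?_, ?_⟩
  · intro y hy y' hy'
    rw [← dist_eq_norm, ← dist_eq_norm]; exact hK.dist_le_mul y hy y' hy'
  · intro y hy
    refine ContinuousLinearMap.opNorm_le_bound _ (by norm_num) fun w => ?_
    rw [NormalPushoff.frame_apply]
    have he₂ : ‖((((0 : ℂ), (1 : ℂ)) : ℂ × ℂ))‖ = 1 := by simp [Prod.norm_def]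
    have hJe : ‖J₂ y ((0 : ℂ), (1 : ℂ))‖ ≤ 2 := by
      calc ‖J₂ y ((0 : ℂ), (1 : ℂ))‖ ≤ ‖J₂ y‖ * ‖((((0 : ℂ), (1 : ℂ)) : ℂ × ℂ))‖ := (J₂ y).le_opNorm _
        _ ≤ 2 * 1 := by rw [he₂]; exact mul_le_mul_of_nonneg_right (hJn y hy) zero_le_one
        _ = 2 := by norm_num
    calc ‖w.re • ((((0 : ℂ), (1 : ℂ)) : ℂ × ℂ)) + w.im • J₂ y ((0 : ℂ), (1 : ℂ))‖
        ≤ ‖w.re • ((((0 : ℂ), (1 : ℂ)) : ℂ × ℂ))‖ + ‖w.im • J₂ y ((0 : ℂ), (1 : ℂ))‖ := norm_add_le _ _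
      _ = |w.re| * 1 + |w.im| * ‖J₂ y ((0 : ℂ), (1 : ℂ))‖ := by
          rw [norm_smul, norm_smul, he₂, Real.norm_eq_abs, Real.norm_eq_abs]
      _ ≤ ‖w‖ * 1 + ‖w‖ * 2 :=
          add_le_add (mul_le_mul_of_nonneg_right (abs_re_le_norm w) zero_le_one)
            (mul_le_mul (abs_im_le_norm w) hJe (norm_nonneg _) (norm_nonneg _))
      _ = 3 * ‖w‖ := by ring
  · intro y hy
    have hd : DifferentiableAt ℝ (NormalPushoff.frame J₂) y :=
      (hframe1.differentiableOn one_ne_zero).differentiableAt (hV.mem_nhds (hKV hy))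
    exact ⟨hd.hasFDerivAt, (hL₁ y hy).trans (le_max_left _ _)⟩

/-! ### C4. The push-off identity -/

/-- **The push-off identity from the fixed-point equations (B.20).** If
`Θ (u z) = ((ξ z)ᵏ, û (ξ z))` on `B(z₀,ρ)`, `s = ξ z'` with `z' ∈ B(z₀,ρ)`, and `(θ, η)` solve
`θᵏ + X̌_η(p) = sᵏ`, `û θ + X̂_η(p) = û s` with `p = (θᵏ, û θ)`, where `ξ⁻¹ θ ∈ B(z₀,ρ)` and
`ξ (ξ⁻¹ θ) = θ`, then `Θ (u (ξ⁻¹ θ)) = p` and `Θ (u z') = p + X_η(p)`: the point `Θ (u z')` is the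
push-off of the branch point `Θ (u (ξ⁻¹ θ))` along the normal frame.
[cite: Wendl2020, App. B, (B.20) and §B.2.5] -/
theorem pushoff_identity {F : Type*} {Θ : F → ℂ × ℂ} {u : ℂ → F} {ξ : OpenPartialHomeomorph ℂ ℂ}
    {uh : ℂ → ℂ} {k : ℕ} {z₀ : ℂ} {ρ : ℝ} {X : ℂ × ℂ → ℂ →L[ℝ] ℂ × ℂ}
    (hnf : ∀ z ∈ ball z₀ ρ, Θ (u z) = ((ξ z) ^ k, uh (ξ z)))
    {z' : ℂ} (hz' : z' ∈ ball z₀ ρ) {θ η : ℂ} (hθρ : ξ.symm θ ∈ ball z₀ ρ) (hξθ : ξ (ξ.symm θ) = θ)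
    (heq1 : θ ^ k + (X (pt k uh θ) η).1 = (ξ z') ^ k)
    (heq2 : uh θ + (X (pt k uh θ) η).2 = uh (ξ z')) :
    Θ (u (ξ.symm θ)) = pt k uh θ ∧ Θ (u z') = pt k uh θ + X (pt k uh θ) η := by
  constructor
  · rw [hnf _ hθρ, hξθ]; rfl
  · rw [hnf _ hz']
    ext
    · simpa [pt] using heq1.symm
    · simpa [pt] using heq2.symm

end Literature.Geometry.Symplectic.RotationBranch

end
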